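import Mathlib
import HarnessLib
import Summits.ResolutionOfSingularities.ResolutionOfSingularities.Theorems.WildQuotientsWildQuotientResolutionS1aGraphMemberAway

/-!
# S1a — K-LOC (α1): principal-centre CHARTS from node power chains / the graph member, SECTION-GLUING FORM (chart + trace formula on `W` and on every affine `U ≤ W`)

[OURS · L1 W4.5c · lead-1 g17 (re-issue of ✓`…S1aMemberChart` p729322 WITHOUT the support formulas, because the hub never built that module's olean — `stale:653:unbuilt` — and everything importing it is parked); lead-1 g16; plan-1 RULINGS R-F15o/R-F15p — K-LOC brick towards ★ R4e-rational `graphTail_killsIn_two`. GEOMETRY (lead-1 g16 finding): the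
level-2 centre of R4e is ONE connected surface — the strict transform `S′` of `S = V(x₀, x₂ − g(x₁))` — read on the `r` producer charts `O′ᵢ₁` (one per critical
point) as the graph members `V(X′₀, φᵢ)`; it is therefore built by ✓`exists_isPrincipalCentre_of_agree_filtration_eq` from CHART filtrations, and the member
producers must return the chart filtration `𝒦₀ = chartFiltration O′ K` itself (principal-centre chart, trace formula on `O′` AND on every affine `U ≤ O′`, support
formula) instead of an already glued single-chart centre] — NOT statements of the manuscript; counted 0; AI-level work, weaker than expert review. Crux
stmt-ResolutionOfSingularities-17941 `CyclicQuotientFourfolds`, line `s1a-logminvertex` v13 (`stub_reachLowerInFX`).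

* ★ `exists_principalCentreChartSec_of_nodePowerChains` — the first half of ✓`exists_isPrincipalCentre_of_nodePowerChains` (no closure hypothesis, no gluing);
* ★ `exists_principalCentreChartSec_of_symMemberGraph` — chart-level ✓`exists_isPrincipalCentre_of_symMemberGraph` (no separating sections needed);
* ★★ `exists_principalCentreChartSec_of_graphChartAway` — chart-level ✓`exists_isPrincipalCentre_of_graphChartAway` (graph member over the localised base).
-/

set_option linter.dupNamespace false

noncomputable section

open CategoryTheory Limits AlgebraicGeometry TopologicalSpace Topology Opposite MvPolynomial
open Literature.AlgebraicGeometry.Resolution Literature.AlgebraicGeometry.RelativeSpec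
open scoped LaurentPolynomial
open Summit.ResolutionOfSingularities.ResolutionOfSingularities.Theorems.WildQuotientResolution.S1
open Summit.ResolutionOfSingularities.ResolutionOfSingularities.Theorems.WildQuotientResolution.S1.NodeAtlas
open Summit.ResolutionOfSingularities.ResolutionOfSingularities.Theorems.WildQuotientResolution.S1.ProducerStep
open Summit.ResolutionOfSingularities.ResolutionOfSingularities.Theorems.WildQuotientResolution.S1.CoarseChart
open Summit.ResolutionOfSingularities.ResolutionOfSingularities.Theorems.WildQuotientResolution.S1.ChartData
open Summit.ResolutionOfSingularities.ResolutionOfSingularities.Theorems.WildQuotientResolution.S1.GoodCharts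
open Summit.ResolutionOfSingularities.ResolutionOfSingularities.Theorems.WildQuotientResolution.S1.KillableTransport
open Summit.ResolutionOfSingularities.ResolutionOfSingularities.Theorems.WildQuotientResolution.S1.NodeTransport
open Summit.ResolutionOfSingularities.ResolutionOfSingularities.Theorems.WildQuotientResolution.S1.CobordantTransport
open Summit.ResolutionOfSingularities.ResolutionOfSingularities.Theorems.WildQuotientResolution.S1.NpFrame
open Summit.ResolutionOfSingularities.ResolutionOfSingularities.Theorems.WildQuotientResolution.S1.KillCert
open Summit.ResolutionOfSingularities.ResolutionOfSingularities.Theorems.WildQuotientResolution.S1.ModelNode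
open Summit.ResolutionOfSingularities.ResolutionOfSingularities.Theorems.WildQuotientResolution.S1.ExtendRees
open Summit.ResolutionOfSingularities.ResolutionOfSingularities.Theorems.WildQuotientResolution.S1.KillGlue
open Summit.ResolutionOfSingularities.ResolutionOfSingularities.Theorems.WildQuotientResolution.S1.BlowupCharts
open Summit.ResolutionOfSingularities.ResolutionOfSingularities.Theorems.WildQuotientResolution.S1.NodeAway
open Summit.ResolutionOfSingularities.ResolutionOfSingularities.Theorems.WildQuotientResolution.S1.CentreAway
open Summit.ResolutionOfSingularities.ResolutionOfSingularities.Theorems.WildQuotientResolution.S1.FreeModel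

namespace Summit.ResolutionOfSingularities.ResolutionOfSingularities.Theorems.WildQuotientResolution.S1.GameFrame.GModel

variable {p : ℕ} {X' X₁ : Scheme.{0}} {q : X' ⟶ X₁} {G : Type} [Group G] {ρ : G →* Aut X'} {g₀ : G}

/-- ★ **A PRINCIPAL-CENTRE CHART FROM A NODE CHART OF POWER-CHAIN TYPE** (chart level: the chart filtration `𝒦₀ = chartFiltration W K` of the trace, with
`W` a principal-centre chart, the trace formula on `W` and on every affine `U ≤ W`, and `supp 𝒦₀_d = closure (V(K_d) ∩ W)`). First half of
✓`exists_isPrincipalCentre_of_nodePowerChains`. [OURS · L1 W4.5c; NOT a statement of the manuscript] -/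
theorem exists_principalCentreChartSec_of_nodePowerChains (M : GModel p q G ρ g₀) (W : M.act.StableAffineOpens) (DW : NodeData p M.act g₀ W)
    {P : Type} [CommRing P] (Φ : letI := DW.instCommRing; DW.B ≃+* P)
    {c : ℕ} (hc : 0 < c) (f : Fin c → P) (δ : Fin c → Π j : Fin DW.m, ZMod (DW.r j)) (w : Fin c → ℕ) (hw : ∀ i, 0 < w i)
    (hdeg : ∀ i, letI := DW.instCommRing; letI := DW.instGradedRing; f i ∈ mapGrading DW.𝒜 Φ (δ i))
    (hK1 : RingTheory.Sequence.IsRegular P (List.ofFn f)) (hK1' : IsRegularRing (P ⧸ Ideal.span (Set.range f)))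
    (d : ℕ)
    (hver : letI := DW.instCommRing; letI := DW.instGradedRing; letI := mapGradedRing DW.𝒜 Φ; VeroneseNormalised (mapGrading DW.𝒜 Φ) f w d)
    (β : P) (sh : ℕ)
    (hadm : letI := DW.instCommRing; ∀ (n : ℕ) (z : P), z ∈ (weightedFiltration f w).ideal n →
      conj Φ DW.σ z - z ∈ Ideal.span {β} * (weightedFiltration f w).ideal (n + sh))
    (hiso : letI := DW.instCommRing; ∃ N : ℕ, Ideal.span (Set.range f) ^ N ≤ (augmentationIdeal (conj Φ DW.σ)).colon (Ideal.span {β}))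
    (hchain : letI := DW.instCommRing; ∀ i, ∃ (mm : ℕ) (u hunit : P), 0 < mm ∧ sh ≤ mm * w i ∧ IsUnit hunit ∧
      u ∈ (weightedFiltration f w).ideal (mm * w i - sh) ∧
      conj Φ DW.σ u - u - β * hunit * f i ^ mm ∈ Ideal.span {β} * (weightedFiltration f w).ideal (mm * w i + 1)) :
    letI := DW.instCommRing; letI := DW.instGradedRing; letI := mapGradedRing DW.𝒜 Φ
    ∃ 𝒦₀ : ReesFiltration M.V, IsPrincipalCentreChart p M.act g₀ 𝒦₀ d W ∧
      (∀ n, (𝒦₀.filtration ⟨W.1, DW.affine⟩).ideal n =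
        ((traceFiltration (mapGrading DW.𝒜 Φ) f w).ideal n).comap
          ((DW.e.trans (zeroRingEquiv DW.𝒜 Φ) : Γ(M.V, W.1) ≃+* ↥(mapGrading DW.𝒜 Φ 0)) : Γ(M.V, W.1) →+* ↥(mapGrading DW.𝒜 Φ 0))) ∧
      (∀ (U : M.V.affineOpens) (hU : U.1 ≤ W.1) (n : ℕ), (𝒦₀.filtration U).ideal n =
        (((traceFiltration (mapGrading DW.𝒜 Φ) f w).ideal n).comap
          ((DW.e.trans (zeroRingEquiv DW.𝒜 Φ) : Γ(M.V, W.1) ≃+* ↥(mapGrading DW.𝒜 Φ 0)) : Γ(M.V, W.1) →+* ↥(mapGrading DW.𝒜 Φ 0))).map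
          (M.V.presheaf.map (homOfLE hU).op).hom) := by
  classical
  letI := DW.instCommRing
  letI := DW.instGradedRing
  letI := mapGradedRing DW.𝒜 Φ
  haveI : IsLocallyNoetherian M.V := M.isLocallyNoetherian
  set eL : Γ(M.V, W.1) ≃+* ↥(mapGrading DW.𝒜 Φ 0) := DW.e.trans (zeroRingEquiv DW.𝒜 Φ) with heL
  -- the transported node
  have htame : IsTameNode p P (mapGrading DW.𝒜 Φ) (conj Φ DW.σ) := isTameNode_map DW.𝒜 Φ p DW.σ DW.tame
  have hσ : ∀ t : Γ(M.V, W.1), ((eL ((M.act.aut g₀⁻¹).hom.appLE W.1 W.1 (W.2.1 g₀⁻¹).ge t) : ↥(mapGrading DW.𝒜 Φ 0)) : P) =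
      conj Φ DW.σ ((eL t : ↥(mapGrading DW.𝒜 Φ 0)) : P) := fun t => by
    change Φ ((DW.e (actO M.act W g₀ t) : ↥(DW.𝒜 0)) : DW.B) = Φ (DW.σ (Φ.symm (Φ ((DW.e t : ↥(DW.𝒜 0)) : DW.B))))
    rw [DW.intertwine t, Φ.symm_apply_apply]
  have hσJ : ∀ n : ℕ, ((weightedFiltration f w).ideal n).map (conj Φ DW.σ : P →+* P) ≤ (weightedFiltration f w).ideal n :=
    map_le_of_admissible_shift f w (conj Φ DW.σ) sh β hadm
  -- the kill clause on every σ-fixed chart, from the power-chain certificate (KC1′)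
  have hkill : ∀ (hp' : 0 < p) (hσp' : ∀ x : P, (⇑(conj Φ DW.σ))^[p] x = x) (d' : ℕ) (b : ↥(mapGrading DW.𝒜 Φ 0))
      (hb : b ∈ (traceFiltration (mapGrading DW.𝒜 Φ) f w).ideal d') (hσb : conj Φ DW.σ (b : P) = b), 0 < d' →
      (augmentationIdeal (sigmaChart (mapGrading DW.𝒜 Φ) f w d' b hb (conj Φ DW.σ) hσJ hp' hσp' hσb)).IsPrincipal :=
    fun hp' hσp' d' b hb hσb hd' =>
      isPrincipal_augmentationIdeal_sigmaChart_of_cert f w (conj Φ DW.σ) hσJ hp' hσp' (mapGrading DW.𝒜 Φ) hd' b hb hσb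
        (cobordantKillCert_of_powerChains_shift f w (conj Φ DW.σ) hσJ hp' hσp' sh β hadm hiso hchain)
  -- the chart filtration of the trace: `W` is a principal-centre chart for it
  let K : IdealFiltration Γ(M.V, W.1) := (traceFiltration (mapGrading DW.𝒜 Φ) f w).comap (eL : Γ(M.V, W.1) →+* ↥(mapGrading DW.𝒜 Φ 0))
  let 𝒦₀ : ReesFiltration M.V := chartFiltration W.1 K
  have h𝒦₀O : ∀ n, (𝒦₀.filtration ⟨W.1, DW.affine⟩).ideal n =
      ((traceFiltration (mapGrading DW.𝒜 Φ) f w).ideal n).comap (eL : Γ(M.V, W.1) →+* ↥(mapGrading DW.𝒜 Φ 0)) := fun n => by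
    rw [filtration_chartFiltration W.1 DW.affine K n]; rfl
  have hprin₀ : IsPrincipalCentreChart p M.act g₀ 𝒦₀ d W :=
    ⟨DW.affine, DW.m, DW.r, P, inferInstance, mapGrading DW.𝒜 Φ, inferInstance, conj Φ DW.σ, eL, htame, hσ, c, f, δ, w, hc, hdeg, hw,
      hK1, hK1', hσJ, h𝒦₀O, hver, hkill⟩
  refine ⟨𝒦₀, hprin₀, h𝒦₀O, fun U hU n => ?_⟩
  rw [ReesFiltration.filtration_ideal, ← (𝒦₀.ideal n).map_ideal (show U ≤ (⟨W.1, DW.affine⟩ : M.V.affineOpens) from hU), ← ReesFiltration.filtration_ideal, h𝒦₀O n]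
  rfl

set_option maxHeartbeats 1600000 in
/-- ★ **THE GRAPH MEMBER OF THE PARALLEL KILL LEAF, CHART LEVEL** (✓`exists_isPrincipalCentre_of_symMemberGraph` without gluing / separating sections).
[OURS · L1 W4.5c · R4 graph member; NOT a statement of the manuscript] -/
theorem exists_principalCentreChartSec_of_symMemberGraph (M : GModel p q G ρ g₀) (W : M.act.StableAffineOpens) (DW : NodeData p M.act g₀ W)
    {P : Type} [CommRing P] (Φ : letI := DW.instCommRing; DW.B ≃+* P)
    (τ : P ≃+* P) (hτ : letI := DW.instCommRing; ∀ x, τ x = Φ (DW.σ (Φ.symm x)))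
    (s X₀ X₁ X₂ x₃ φ T H q₁ q₂ hu r : P) (δ : ℕ) (Gfix : Set P)
    (hs : τ s = s) (hX₀ : τ X₀ = X₀) (hX₁ : τ X₁ = X₁ + q₁ * (s ^ δ * X₀)) (hX₂ : τ X₂ = X₂ + q₂ * (s ^ δ * X₀))
    (hx₃ : τ x₃ = x₃ + s ^ δ * T) (hφ : τ φ = φ + s ^ δ * X₀ * hu + (s ^ δ * X₀) ^ 2 * r) (hq₁ : IsUnit q₁) (hhu : IsUnit hu)
    (hXR : T = H * φ) (hH : IsUnit H)
    (hfix : ∀ g ∈ Gfix, τ g = g) (hgen : Subring.closure (({s, X₀, X₁, X₂, x₃} : Set P) ∪ Gfix) = ⊤)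
    (hK1 : RingTheory.Sequence.IsRegular P (List.ofFn (![X₀, φ] : Fin 2 → P))) (hK1' : IsRegularRing (P ⧸ Ideal.span (Set.range (![X₀, φ] : Fin 2 → P))))
    (θ₀ θ₁ : Π j : Fin DW.m, ZMod (DW.r j))
    (hX₀d : letI := DW.instCommRing; letI := DW.instGradedRing; X₀ ∈ mapGrading DW.𝒜 Φ θ₀)
    (hφd : letI := DW.instCommRing; letI := DW.instGradedRing; φ ∈ mapGrading DW.𝒜 Φ θ₁)
    (d : ℕ)
    (hver : letI := DW.instCommRing; letI := DW.instGradedRing; letI := mapGradedRing DW.𝒜 Φ; VeroneseNormalised (mapGrading DW.𝒜 Φ) (![X₀, φ] : Fin 2 → P) ![2, 1] d) :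
    letI := DW.instCommRing; letI := DW.instGradedRing; letI := mapGradedRing DW.𝒜 Φ
    ∃ 𝒦₀ : ReesFiltration M.V, IsPrincipalCentreChart p M.act g₀ 𝒦₀ d W ∧
      (∀ n, (𝒦₀.filtration ⟨W.1, DW.affine⟩).ideal n =
        ((traceFiltration (mapGrading DW.𝒜 Φ) (![X₀, φ] : Fin 2 → P) ![2, 1]).ideal n).comap
          ((DW.e.trans (zeroRingEquiv DW.𝒜 Φ) : Γ(M.V, W.1) ≃+* ↥(mapGrading DW.𝒜 Φ 0)) : Γ(M.V, W.1) →+* ↥(mapGrading DW.𝒜 Φ 0))) ∧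
      (∀ (U : M.V.affineOpens) (hU : U.1 ≤ W.1) (n : ℕ), (𝒦₀.filtration U).ideal n =
        (((traceFiltration (mapGrading DW.𝒜 Φ) (![X₀, φ] : Fin 2 → P) ![2, 1]).ideal n).comap
          ((DW.e.trans (zeroRingEquiv DW.𝒜 Φ) : Γ(M.V, W.1) ≃+* ↥(mapGrading DW.𝒜 Φ 0)) : Γ(M.V, W.1) →+* ↥(mapGrading DW.𝒜 Φ 0))).map
          (M.V.presheaf.map (homOfLE hU).op).hom) := by
  classical
  letI := DW.instCommRing
  letI := DW.instGradedRing
  letI := mapGradedRing DW.𝒜 Φ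
  have hτeq : (conj Φ DW.σ : P ≃+* P) = τ := RingEquiv.ext fun x => (hτ x).symm
  have hadm := (Sym.symG_admissible_map_le τ s X₀ X₁ X₂ x₃ φ T H q₁ q₂ hu r δ Gfix hs hX₀ hX₁ hX₂ hx₃ hφ hXR hfix hgen).1
  have hiso := Sym.symG_isolation τ s X₀ X₁ x₃ φ T H q₁ δ hX₁ hx₃ hXR hq₁ hH
  have hchain := Sym.symG_chains τ s X₀ x₃ φ T H hu r δ hx₃ hφ hXR hhu hH
  rw [← hτeq] at hadm hiso hchain
  exact exists_principalCentreChartSec_of_nodePowerChains M W DW Φ two_pos (![X₀, φ] : Fin 2 → P) ![θ₀, θ₁] ![2, 1]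
    (fun i => by fin_cases i <;> norm_num) (fun i => by fin_cases i <;> assumption) hK1 hK1' d hver (s ^ δ) 1 hadm hiso hchain

set_option maxHeartbeats 8000000 in
set_option synthInstance.maxHeartbeats 400000 in
/-- ★★ **THE GRAPH MEMBER ON A PRODUCER CHART OF AN R4 ROOT OVER THE LOCALISED BASE, CHART LEVEL** (✓`exists_isPrincipalCentre_of_graphChartAway` returning
the chart filtration for multi-chart gluing). [OURS · L1 W4.5c · K-LOC (α1); NOT a statement of the manuscript] -/
theorem exists_principalCentreChartSec_of_graphChartAway
    {k : Type} [Field k] (σ : MvPolynomial (Fin 4) k ≃+* MvPolynomial (Fin 4) k) (hC : ∀ a : k, σ (C a) = C a)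
    (h0 : σ (X 0) = X 0) (h1 : σ (X 1) = X 1 + X 0) (h2 : σ (X 2) = X 2) (t₀ : MvPolynomial (Fin 4) k) (h3 : σ (X 3) = X 3 + t₀)
    (w : Fin 3 → ℕ) (sh : ℕ) (hw0 : w 0 = w 1 + sh)
    (ht₀ : t₀ ∈ (weightedFiltration (fun i => (X ((![0, 1, 2] : Fin 3 → Fin 4) i) : MvPolynomial (Fin 4) k)) w).ideal sh)
    (hh : MvPolynomial (Fin 4) k) (hσh : σ hh = hh)
    (hp : 0 < p) (hσpL : ∀ y : (Localization.Away hh), (⇑(sigmaAway σ hσh))^[p] y = y)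
    (hσJ : ∀ n : ℕ, ((weightedFiltration (fun i => algebraMap (MvPolynomial (Fin 4) k) (Localization.Away hh) (X ((![0, 1, 2] : Fin 3 → Fin 4) i))) w).ideal n).map (sigmaAway σ hσh : (Localization.Away hh) →+* (Localization.Away hh)) ≤ (weightedFiltration (fun i => algebraMap (MvPolynomial (Fin 4) k) (Localization.Away hh) (X ((![0, 1, 2] : Fin 3 → Fin 4) i))) w).ideal n)
    {mg : ℕ} (mo : Fin mg → ℕ) (𝒜 : (Π j : Fin mg, ZMod (mo j)) → AddSubgroup (Localization.Away hh)) [GradedRing 𝒜]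
    (hf : ∀ i, (fun i => algebraMap (MvPolynomial (Fin 4) k) (Localization.Away hh) (X ((![0, 1, 2] : Fin 3 → Fin 4) i))) i ∈ 𝒜 ((fun _ => (0 : Π j : Fin mg, ZMod (mo j))) i)) (ht0A : algebraMap (MvPolynomial (Fin 4) k) (Localization.Away hh) t₀ ∈ 𝒜 0)
    {dbar : ℕ} (y : ↥(𝒜 0)) (hy : y ∈ (traceFiltration 𝒜 (fun i => algebraMap (MvPolynomial (Fin 4) k) (Localization.Away hh) (X ((![0, 1, 2] : Fin 3 → Fin 4) i))) w).ideal dbar) (hσy : sigmaAway σ hσh (y : (Localization.Away hh)) = y)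
    -- the pinned chart model
    (qd : (MvPolynomial (Option (Fin 4)) k)) (hq0 : qd ≠ 0) (Φ : (ChartRing 𝒜 (fun i => algebraMap (MvPolynomial (Fin 4) k) (Localization.Away hh) (X ((![0, 1, 2] : Fin 3 → Fin 4) i))) w dbar y hy) ≃+* (Localization.Away qd))
    (hΦa : ∀ a : (MvPolynomial (Fin 4) k), Φ (algebraMap ↥(cobordantAlgebra (fun i => algebraMap (MvPolynomial (Fin 4) k) (Localization.Away hh) (X ((![0, 1, 2] : Fin 3 → Fin 4) i))) w) (ChartRing 𝒜 (fun i => algebraMap (MvPolynomial (Fin 4) k) (Localization.Away hh) (X ((![0, 1, 2] : Fin 3 → Fin 4) i))) w dbar y hy) (algebraMap (Localization.Away hh) ↥(cobordantAlgebra (fun i => algebraMap (MvPolynomial (Fin 4) k) (Localization.Away hh) (X ((![0, 1, 2] : Fin 3 → Fin 4) i))) w) (algebraMap (MvPolynomial (Fin 4) k) (Localization.Away hh) a))) = (algebraMap (MvPolynomial (Option (Fin 4)) k) (Localization.Away qd)) (cobordantAlgebra.subst k (![w 0, w 1, w 2, 0] : Fin 4 → ℕ) a))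
    (hΦs : Φ (algebraMap ↥(cobordantAlgebra (fun i => algebraMap (MvPolynomial (Fin 4) k) (Localization.Away hh) (X ((![0, 1, 2] : Fin 3 → Fin 4) i))) w) (ChartRing 𝒜 (fun i => algebraMap (MvPolynomial (Fin 4) k) (Localization.Away hh) (X ((![0, 1, 2] : Fin 3 → Fin 4) i))) w dbar y hy) (cobordantAlgebra.s (fun i => algebraMap (MvPolynomial (Fin 4) k) (Localization.Away hh) (X ((![0, 1, 2] : Fin 3 → Fin 4) i))) w)) = (algebraMap (MvPolynomial (Option (Fin 4)) k) (Localization.Away qd)) (X none))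
    (hΦu : ∀ i : Fin 3, Φ (algebraMap ↥(cobordantAlgebra (fun i => algebraMap (MvPolynomial (Fin 4) k) (Localization.Away hh) (X ((![0, 1, 2] : Fin 3 → Fin 4) i))) w) (ChartRing 𝒜 (fun i => algebraMap (MvPolynomial (Fin 4) k) (Localization.Away hh) (X ((![0, 1, 2] : Fin 3 → Fin 4) i))) w dbar y hy) (cobordantAlgebra.u' (fun i => algebraMap (MvPolynomial (Fin 4) k) (Localization.Away hh) (X ((![0, 1, 2] : Fin 3 → Fin 4) i))) w i)) = (algebraMap (MvPolynomial (Option (Fin 4)) k) (Localization.Away qd)) (X (some ((![0, 1, 2] : Fin 3 → Fin 4) i))))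
    (hτq : conj Φ (sigmaChart 𝒜 (fun i => algebraMap (MvPolynomial (Fin 4) k) (Localization.Away hh) (X ((![0, 1, 2] : Fin 3 → Fin 4) i))) w dbar y hy (sigmaAway σ hσh) hσJ hp hσpL hσy) ((algebraMap (MvPolynomial (Option (Fin 4)) k) (Localization.Away qd)) qd) = (algebraMap (MvPolynomial (Option (Fin 4)) k) (Localization.Away qd)) qd)
    -- the graph tail
    (Gq : MvPolynomial (Fin 2) k) (hT' : cobordantAlgebra.subst k (![w 0, w 1, w 2, 0] : Fin 4 → ℕ) t₀ = X none ^ sh * (X (some 2) - rename (![none, some 1] : Fin 2 → Option (Fin 4)) Gq))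
    (hGu : IsUnit ((algebraMap (MvPolynomial (Option (Fin 4)) k) (Localization.Away qd)) (rename (![none, some 1] : Fin 2 → Option (Fin 4)) (pderiv 1 Gq))))
    (hu : MvPolynomial.eval (fun o : Option (Fin 4) => o.elim (0 : k) ![0, 1, MvPolynomial.eval ![0, 1] Gq, 0]) qd ≠ 0)
    -- the chart and its producer node
    (M : GModel p q G ρ g₀) (W : M.act.StableAffineOpens) (hW : IsAffineOpen W.1)
    (E : letI := chartNodeGradedRing mo 𝒜 (fun i => algebraMap (MvPolynomial (Fin 4) k) (Localization.Away hh) (X ((![0, 1, 2] : Fin 3 → Fin 4) i))) w hf dbar y hy; Γ(M.V, W.1) ≃+* ↥((chartNodeGrading mo 𝒜 (fun i => algebraMap (MvPolynomial (Fin 4) k) (Localization.Away hh) (X ((![0, 1, 2] : Fin 3 → Fin 4) i))) w hf dbar y hy) 0))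
    (htame : letI := chartNodeGradedRing mo 𝒜 (fun i => algebraMap (MvPolynomial (Fin 4) k) (Localization.Away hh) (X ((![0, 1, 2] : Fin 3 → Fin 4) i))) w hf dbar y hy; IsTameNode p (ChartRing 𝒜 (fun i => algebraMap (MvPolynomial (Fin 4) k) (Localization.Away hh) (X ((![0, 1, 2] : Fin 3 → Fin 4) i))) w dbar y hy) (chartNodeGrading mo 𝒜 (fun i => algebraMap (MvPolynomial (Fin 4) k) (Localization.Away hh) (X ((![0, 1, 2] : Fin 3 → Fin 4) i))) w hf dbar y hy) (sigmaChart 𝒜 (fun i => algebraMap (MvPolynomial (Fin 4) k) (Localization.Away hh) (X ((![0, 1, 2] : Fin 3 → Fin 4) i))) w dbar y hy (sigmaAway σ hσh) hσJ hp hσpL hσy))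
    (hE : letI := chartNodeGradedRing mo 𝒜 (fun i => algebraMap (MvPolynomial (Fin 4) k) (Localization.Away hh) (X ((![0, 1, 2] : Fin 3 → Fin 4) i))) w hf dbar y hy
      ∀ t' : Γ(M.V, W.1), ((E ((M.act.aut g₀⁻¹).hom.appLE W.1 W.1 (W.2.1 g₀⁻¹).ge t') : ↥((chartNodeGrading mo 𝒜 (fun i => algebraMap (MvPolynomial (Fin 4) k) (Localization.Away hh) (X ((![0, 1, 2] : Fin 3 → Fin 4) i))) w hf dbar y hy) 0)) : (ChartRing 𝒜 (fun i => algebraMap (MvPolynomial (Fin 4) k) (Localization.Away hh) (X ((![0, 1, 2] : Fin 3 → Fin 4) i))) w dbar y hy)) = (sigmaChart 𝒜 (fun i => algebraMap (MvPolynomial (Fin 4) k) (Localization.Away hh) (X ((![0, 1, 2] : Fin 3 → Fin 4) i))) w dbar y hy (sigmaAway σ hσh) hσJ hp hσpL hσy) ((E t' : ↥((chartNodeGrading mo 𝒜 (fun i => algebraMap (MvPolynomial (Fin 4) k) (Localization.Away hh) (X ((![0, 1, 2] : Fin 3 → Fin 4) i))) w hf dbar y hy) 0)) : (ChartRing 𝒜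 (fun i => algebraMap (MvPolynomial (Fin 4) k) (Localization.Away hh) (X ((![0, 1, 2] : Fin 3 → Fin 4) i))) w dbar y hy)))
    -- the Veronese degree
    (d : ℕ) (l : ℕ) (hl : 0 < l)
    (hver : letI := chartNodeGradedRing mo 𝒜 (fun i => algebraMap (MvPolynomial (Fin 4) k) (Localization.Away hh) (X ((![0, 1, 2] : Fin 3 → Fin 4) i))) w hf dbar y hy; letI := mapGradedRing (chartNodeGrading mo 𝒜 (fun i => algebraMap (MvPolynomial (Fin 4) k) (Localization.Away hh) (X ((![0, 1, 2] : Fin 3 → Fin 4) i))) w hf dbar y hy) Φ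
      VeroneseNormalised (mapGrading (chartNodeGrading mo 𝒜 (fun i => algebraMap (MvPolynomial (Fin 4) k) (Localization.Away hh) (X ((![0, 1, 2] : Fin 3 → Fin 4) i))) w hf dbar y hy) Φ) (![(algebraMap (MvPolynomial (Option (Fin 4)) k) (Localization.Away qd)) (X (some 0)), (algebraMap (MvPolynomial (Option (Fin 4)) k) (Localization.Away qd)) (X (some 2) - rename (![none, some 1] : Fin 2 → Option (Fin 4)) Gq)] : Fin 2 → (Localization.Away qd)) ![2, 1] d) :
    letI := chartNodeGradedRing mo 𝒜 (fun i => algebraMap (MvPolynomial (Fin 4) k) (Localization.Away hh) (X ((![0, 1, 2] : Fin 3 → Fin 4) i))) w hf dbar y hy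
    letI := mapGradedRing (chartNodeGrading mo 𝒜 (fun i => algebraMap (MvPolynomial (Fin 4) k) (Localization.Away hh) (X ((![0, 1, 2] : Fin 3 → Fin 4) i))) w hf dbar y hy) Φ
    ∃ 𝒦₀ : ReesFiltration M.V, IsPrincipalCentreChart p M.act g₀ 𝒦₀ (d * l) W ∧
      (∀ n, (𝒦₀.filtration ⟨W.1, hW⟩).ideal n =
        ((traceFiltration (mapGrading (chartNodeGrading mo 𝒜 (fun i => algebraMap (MvPolynomial (Fin 4) k) (Localization.Away hh) (X ((![0, 1, 2] : Fin 3 → Fin 4) i))) w hf dbar y hy) Φ) (![(algebraMap (MvPolynomial (Option (Fin 4)) k) (Localization.Away qd)) (X (some 0)), (algebraMap (MvPolynomial (Option (Fin 4)) k) (Localization.Away qd)) (X (some 2) - rename (![none, some 1] : Fin 2 → Option (Fin 4)) Gq)] : Fin 2 → (Localization.Away qd)) ![2, 1]).ideal n).comap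
          ((E.trans (zeroRingEquiv (chartNodeGrading mo 𝒜 (fun i => algebraMap (MvPolynomial (Fin 4) k) (Localization.Away hh) (X ((![0, 1, 2] : Fin 3 → Fin 4) i))) w hf dbar y hy) Φ) : Γ(M.V, W.1) ≃+* _) : Γ(M.V, W.1) →+* _)) ∧
      (∀ (U : M.V.affineOpens) (hU : U.1 ≤ W.1) (n : ℕ), (𝒦₀.filtration U).ideal n =
        (((traceFiltration (mapGrading (chartNodeGrading mo 𝒜 (fun i => algebraMap (MvPolynomial (Fin 4) k) (Localization.Away hh) (X ((![0, 1, 2] : Fin 3 → Fin 4) i))) w hf dbar y hy) Φ) (![(algebraMap (MvPolynomial (Option (Fin 4)) k) (Localization.Away qd)) (X (some 0)), (algebraMap (MvPolynomial (Option (Fin 4)) k) (Localization.Away qd)) (X (some 2) - rename (![none, some 1] : Fin 2 → Option (Fin 4)) Gq)] : Fin 2 → (Localization.Away qd)) ![2, 1]).ideal n).comap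
          ((E.trans (zeroRingEquiv (chartNodeGrading mo 𝒜 (fun i => algebraMap (MvPolynomial (Fin 4) k) (Localization.Away hh) (X ((![0, 1, 2] : Fin 3 → Fin 4) i))) w hf dbar y hy) Φ) : Γ(M.V, W.1) ≃+* _) : Γ(M.V, W.1) →+* ↥(mapGrading (chartNodeGrading mo 𝒜 (fun i => algebraMap (MvPolynomial (Fin 4) k) (Localization.Away hh) (X ((![0, 1, 2] : Fin 3 → Fin 4) i))) w hf dbar y hy) Φ 0))).map
          (M.V.presheaf.map (homOfLE hU).op).hom) := by
  letI instN := chartNodeGradedRing mo 𝒜 (fun i => algebraMap (MvPolynomial (Fin 4) k) (Localization.Away hh) (X ((![0, 1, 2] : Fin 3 → Fin 4) i))) w hf dbar y hy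
  letI instP := mapGradedRing (chartNodeGrading mo 𝒜 (fun i => algebraMap (MvPolynomial (Fin 4) k) (Localization.Away hh) (X ((![0, 1, 2] : Fin 3 → Fin 4) i))) w hf dbar y hy) Φ
  have hver' := CoarseChart.veroneseNormalised_mul _ _ _ hver hl
  have ht : algebraMap (MvPolynomial (Fin 4) k) (Localization.Away hh) t₀ ∈ (weightedFiltration (fun i => algebraMap (MvPolynomial (Fin 4) k) (Localization.Away hh) (X ((![0, 1, 2] : Fin 3 → Fin 4) i))) w).ideal sh := KillCert.QhAway.qhl_tail_mem t₀ w sh ht₀ hh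
  -- rows of `τ′ = conj Φ σ_chart`
  obtain ⟨rn, r0, r2, rC⟩ := KillCert.QhAway.qhc_rows_fixed σ hC h0 h1 h2 t₀ h3 w hh hσh hp hσpL hσJ mo 𝒜 y hy hσy Φ hΦa hΦs hΦu
  have r1 := KillCert.QhAway.qhc_row_one σ h0 h1 h2 t₀ h3 w sh hw0 hh hσh hp hσpL hσJ mo 𝒜 y hy hσy Φ hΦs hΦu
  have r3 := KillCert.QhAway.qhc_row_three σ t₀ h3 w sh hh hσh hp hσpL hσJ mo 𝒜 y hy hσy Φ hΦa (X (some 2) - rename (![none, some 1] : Fin 2 → Option (Fin 4)) Gq) hT'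
  have hφeq := KillCert.QhAway.qhc_tail_eq t₀ w sh hh mo 𝒜 y hy hq0 Φ hΦa hΦs ht (X (some 2) - rename (![none, some 1] : Fin 2 → Option (Fin 4)) Gq) hT'
  -- polynomials in `(x_none, x′₁)` read in the model
  have halg : ∀ r : (MvPolynomial (Option (Fin 4)) k), (algebraMap (MvPolynomial (Option (Fin 4)) k) (Localization.Away qd)) r = eval₂ (algebraMap k (Localization.Away qd)) (fun o => (algebraMap (MvPolynomial (Option (Fin 4)) k) (Localization.Away qd)) (X o)) r := fun r => by
    conv_lhs => rw [← MvPolynomial.eval₂_eta r]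
    rw [MvPolynomial.eval₂_comp_left, IsScalarTower.algebraMap_eq k (MvPolynomial (Option (Fin 4)) k) (Localization.Away qd), MvPolynomial.algebraMap_eq]
    rfl
  have hev : ∀ Q : MvPolynomial (Fin 2) k, (algebraMap (MvPolynomial (Option (Fin 4)) k) (Localization.Away qd)) (rename (![none, some 1] : Fin 2 → Option (Fin 4)) Q) = eval₂ (algebraMap k (Localization.Away qd)) (![(algebraMap (MvPolynomial (Option (Fin 4)) k) (Localization.Away qd)) (X none), (algebraMap (MvPolynomial (Option (Fin 4)) k) (Localization.Away qd)) (X (some 1))] : Fin 2 → (Localization.Away qd)) Q := fun Q => by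
    rw [halg, MvPolynomial.eval₂_rename]
    congr 1
    funext i
    fin_cases i <;> rfl
  -- the Taylor expansion of the row of `G(x_none, x′₁)`
  obtain ⟨R, hR⟩ := FreeModel.exists_map_eval₂_eq_of_shift (algebraMap k (Localization.Away qd)) (![(algebraMap (MvPolynomial (Option (Fin 4)) k) (Localization.Away qd)) (X none), (algebraMap (MvPolynomial (Option (Fin 4)) k) (Localization.Away qd)) (X (some 1))] : Fin 2 → (Localization.Away qd)) 1
    ((algebraMap (MvPolynomial (Option (Fin 4)) k) (Localization.Away qd)) (X none) ^ sh * (algebraMap (MvPolynomial (Option (Fin 4)) k) (Localization.Away qd)) (X (some 0))) ((conj Φ (sigmaChart 𝒜 (fun i => algebraMap (MvPolynomial (Fin 4) k) (Localization.Away hh) (X ((![0, 1, 2] : Fin 3 → Fin 4) i))) w dbar y hy (sigmaAway σ hσh) hσJ hp hσpL hσy) : (Localization.Away qd) ≃+* (Localization.Away qd)) : (Localization.Away qd) →+* (Localization.Away qd))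
    (fun a => by rw [RingHom.coe_coe, IsScalarTower.algebraMap_apply k (MvPolynomial (Option (Fin 4)) k) (Localization.Away qd) a, MvPolynomial.algebraMap_eq]; exact rC a)
    (by rw [RingHom.coe_coe]; exact r1)
    (fun j hj => by
      fin_cases j
      · rw [RingHom.coe_coe]; exact rn
      · exact absurd rfl hj) Gq
  rw [RingHom.coe_coe] at hR
  -- the component `φ = x′₂ − G`: row
  have hφrow : conj Φ (sigmaChart 𝒜 (fun i => algebraMap (MvPolynomial (Fin 4) k) (Localization.Away hh) (X ((![0, 1, 2] : Fin 3 → Fin 4) i))) w dbar y hy (sigmaAway σ hσh) hσJ hp hσpL hσy) ((algebraMap (MvPolynomial (Option (Fin 4)) k) (Localization.Away qd)) (X (some 2) - rename (![none, some 1] : Fin 2 → Option (Fin 4)) Gq)) =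
      (algebraMap (MvPolynomial (Option (Fin 4)) k) (Localization.Away qd)) (X (some 2) - rename (![none, some 1] : Fin 2 → Option (Fin 4)) Gq) + (algebraMap (MvPolynomial (Option (Fin 4)) k) (Localization.Away qd)) (X none) ^ sh * (algebraMap (MvPolynomial (Option (Fin 4)) k) (Localization.Away qd)) (X (some 0)) * (-((algebraMap (MvPolynomial (Option (Fin 4)) k) (Localization.Away qd)) (rename (![none, some 1] : Fin 2 → Option (Fin 4)) (pderiv 1 Gq)))) +
        ((algebraMap (MvPolynomial (Option (Fin 4)) k) (Localization.Away qd)) (X none) ^ sh * (algebraMap (MvPolynomial (Option (Fin 4)) k) (Localization.Away qd)) (X (some 0))) ^ 2 * (-R) := by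
    rw [map_sub, map_sub, r2, hev Gq, hR, hev (pderiv 1 Gq)]
    ring
  -- K1′ by the graph shear
  obtain ⟨hK1, hK1'⟩ := FreeModel.isRegular_away_X_graph k qd (some 0) (some 2) (by decide) (rename (![none, some 1] : Fin 2 → Option (Fin 4)) Gq)
    (fun f hf' => by
      have hfv : (f ∘ (![none, some 1] : Fin 2 → Option (Fin 4))) = (X ∘ (![none, some 1] : Fin 2 → Option (Fin 4))) := by
        funext i
        fin_cases i
        exacts [hf' none (by decide), hf' (some 1) (by decide)]
      rw [MvPolynomial.aeval_rename, hfv, ← MvPolynomial.aeval_rename, MvPolynomial.aeval_X_left_apply])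
    (fun o : Option (Fin 4) => o.elim (0 : k) ![0, 1, MvPolynomial.eval ![0, 1] Gq, 0]) rfl
    (by
      have hpv : ((fun o : Option (Fin 4) => o.elim (0 : k) ![0, 1, MvPolynomial.eval ![0, 1] Gq, 0]) ∘ (![none, some 1] : Fin 2 → Option (Fin 4))) = ![0, 1] := by
        funext i
        fin_cases i <;> rfl
      rw [MvPolynomial.eval_rename, hpv]
      rfl) hu
  -- `τ′` fixes `q⁻¹` and the constants
  have hfix : ∀ g' ∈ (({IsLocalization.Away.invSelf qd} : Set (Localization.Away qd)) ∪ Set.range (algebraMap k (Localization.Away qd))), conj Φ (sigmaChart 𝒜 (fun i => algebraMap (MvPolynomial (Fin 4) k) (Localization.Away hh) (X ((![0, 1, 2] : Fin 3 → Fin 4) i))) w dbar y hy (sigmaAway σ hσh) hσJ hp hσpL hσy) g' = g' := by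
    rintro g' (hg | ⟨a, rfl⟩)
    · rw [Set.mem_singleton_iff.mp hg]
      exact KillCert.QhAway.map_invSelf_of_map_algebraMap qd _ hτq
    · rw [IsScalarTower.algebraMap_apply k (MvPolynomial (Option (Fin 4)) k) (Localization.Away qd) a, MvPolynomial.algebraMap_eq]
      exact rC a
  -- degrees
  have dg0 := KillCert.QhAway.qhc_degree_u' w hh mo 𝒜 hf y hy Φ hΦu 0
  have hφd : (algebraMap (MvPolynomial (Option (Fin 4)) k) (Localization.Away qd)) (X (some 2) - rename (![none, some 1] : Fin 2 → Option (Fin 4)) Gq) ∈ mapGrading (chartNodeGrading mo 𝒜 (fun i => algebraMap (MvPolynomial (Fin 4) k) (Localization.Away hh) (X ((![0, 1, 2] : Fin 3 → Fin 4) i))) w hf dbar y hy) Φ (sh • (consIndexEquiv mo ((1 : ℤ), (0 : Π j : Fin mg, ZMod (mo j))))) := by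
    rw [← hφeq]
    exact KillCert.QhAway.qhc_degree_tail t₀ w sh hh mo 𝒜 hf y hy Φ ht ht0A
  exact exists_principalCentreChartSec_of_symMemberGraph M W
    ({ affine := hW, m := mg + 1, r := Fin.cons 0 mo, B := (ChartRing 𝒜 (fun i => algebraMap (MvPolynomial (Fin 4) k) (Localization.Away hh) (X ((![0, 1, 2] : Fin 3 → Fin 4) i))) w dbar y hy), 𝒜 := (chartNodeGrading mo 𝒜 (fun i => algebraMap (MvPolynomial (Fin 4) k) (Localization.Away hh) (X ((![0, 1, 2] : Fin 3 → Fin 4) i))) w hf dbar y hy), σ := (sigmaChart 𝒜 (fun i => algebraMap (MvPolynomial (Fin 4) k) (Localization.Away hh) (X ((![0, 1, 2] : Fin 3 → Fin 4) i))) w dbar y hy (sigmaAway σ hσh) hσJ hp hσpL hσy), e := E, tame := htame, intertwine := hE } : NodeData p M.act g₀ W)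
    Φ (conj Φ (sigmaChart 𝒜 (fun i => algebraMap (MvPolynomial (Fin 4) k) (Localization.Away hh) (X ((![0, 1, 2] : Fin 3 → Fin 4) i))) w dbar y hy (sigmaAway σ hσh) hσJ hp hσpL hσy)) (fun _ => rfl)
    ((algebraMap (MvPolynomial (Option (Fin 4)) k) (Localization.Away qd)) (X none)) ((algebraMap (MvPolynomial (Option (Fin 4)) k) (Localization.Away qd)) (X (some 0))) ((algebraMap (MvPolynomial (Option (Fin 4)) k) (Localization.Away qd)) (X (some 1))) ((algebraMap (MvPolynomial (Option (Fin 4)) k) (Localization.Away qd)) (X (some 2))) ((algebraMap (MvPolynomial (Option (Fin 4)) k) (Localization.Away qd)) (X (some 3)))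
    ((algebraMap (MvPolynomial (Option (Fin 4)) k) (Localization.Away qd)) (X (some 2) - rename (![none, some 1] : Fin 2 → Option (Fin 4)) Gq)) ((algebraMap (MvPolynomial (Option (Fin 4)) k) (Localization.Away qd)) (X (some 2) - rename (![none, some 1] : Fin 2 → Option (Fin 4)) Gq))
    1 1 0 (-((algebraMap (MvPolynomial (Option (Fin 4)) k) (Localization.Away qd)) (rename (![none, some 1] : Fin 2 → Option (Fin 4)) (pderiv 1 Gq)))) (-R) sh _
    rn r0 (by rw [one_mul]; exact r1) (by rw [zero_mul, add_zero]; exact r2) r3 hφrow isUnit_one hGu.neg (one_mul _).symm isUnit_one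
    hfix (A1.a1_model_closure_eq_top _) hK1 hK1' _ _ dg0 hφd (d * l) hver'

end Summit.ResolutionOfSingularities.ResolutionOfSingularities.Theorems.WildQuotientResolution.S1.GameFrame.GModel

end
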